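import Literature.NumberTheory.ConnesMoscovici2022.UVProlateSADomainStructure
import Literature.NumberTheory.ConnesMoscovici2022.UVProlateNegativeEigenSimple
import HarnessLib

/-!
# Connes–Moscovici 2022, Theorem 5.1: finite multiplicity windows (clause 2) and the reduction of the
# named fact to its semiclassical counting clause

LINE 1 — FRAMING. RH-FREE corpus literature (spectral bookkeeping for the prolate wave operator
`W_λ = −∂ₓ(λ² − x²)∂ₓ + (2πλx)²` on `L²(ℝ)`; cell rh-crit C1, sequel row O2 `UVProlateSpectrum`, no
leaf / binder / K-path role).  bears_on: LADDER-RH W-C/W-P only, via the named fact `CM22_thm_5_1`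
(which STAYS a named fact).  WHAT THIS IS NOT: any claim about `ζ` or RH, and not an endorsement of
the printed identification «true eigenvalue count = semiclassical count»; nothing here bears on the
truth of RH.  Theorems only (0 `def`s, 0 named facts, no `sorry`).

Source: A. Connes, H. Moscovici, *The UV prolate spectrum matches the zeros of zeta*, PNAS 119
(2022) [bib `ConnesMoscovici2022`] = arXiv:2112.05500, §5 Thm 5.1 (= arXiv §6 Thm 6.1, held text
`paper-arxiv-2112.05500` chunk p0011:L6–L22) and §1 Thm 1.6 (iv) (chunk p0006:L79, L95–L114:
«the spectrum of `W_sa` is discrete … the eigenvalues … have finite multiplicity»).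

The named fact `CM22_thm_5_1` (`UVProlateSpectrum.lean`) is typed as three clauses about
`W = W_sa` at `λ = √2`: (1) every negative even-sector eigenvalue is simple; (2) for every `E` the
even-sector eigenspaces with eigenvalue in `[−(E/2)², 0)` span a finite-dimensional space; (3) the
count `N(E)` is `(E/2π)(log(E/2π) − 1) + O(1)`.  Clause (1) is the tree's
`finrank_eigenspace_inf_evenPart_le_one` (seat cc-t14 g2, every `λ`).  This file proves clause (2)
for every `λ > 0` from Theorem 1.6 (iv) (seat cc-t8 g4's `CM22_thm_1_6_iv` over the tree's
self-adjointness and compact resolvent of `W_sa`): an orthonormal eigenbasis `(b_n, μ_n)` with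
`|μ_n| → ∞` confines every eigenvector for `ν` to the finite span of the `b_n` with `μ_n = ν`, and a
bounded window of `ν`'s meets only finitely many `μ_n`.  The socket `CM22_thm_5_1_of_counting` then
reduces the named fact to EXACTLY its clause (3) — the semiclassical Weyl-type count with `O(1)`
error, recorded as printed and not proved here.

## What is proved

* `inner_eigenvector_eq_zero_of_ne` — for a symmetric `W`, basis eigenvectors with `μ_n ≠ ν` are
  orthogonal to the `ν`-eigenspace;
* `eigenspace_le_span_of_hilbertBasis` — the `ν`-eigenspace lies in the span of finitely many basis
  vectors (those `b_n`, `n < N`, once `|μ_n| > |ν|` for `n ≥ N`);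
* `finiteDimensional_iSup_eigenspace_of_hasDiscreteSpectrum` — bounded windows of eigenvalues carry
  a finite-dimensional sum of eigenspaces;
* **`CM22_thm_5_1_ii`** — clause (2) of `CM22_thm_5_1`, for every `λ > 0` and every `W` with
  `IsProlateSA λ W`;
* **`CM22_thm_5_1_of_counting`** — `CM22_thm_5_1` from its counting clause alone.

Cell rh-crit seat cc-t14 g4.  Nothing in this file bears on the truth of RH.
-/

noncomputable section

open Complex Set MeasureTheory Filter
open scoped Real Topology InnerProductSpace
open _root_.LinearPMap Literature.Analysis.UnboundedOperators

namespace Literature.NumberTheory.ConnesMoscovici2022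

open Literature.NumberTheory.ConnesConsani2021 Literature.NumberTheory.ConnesConsani2024

variable {lam : ℝ}

/-! ## §1. Eigenvectors of a symmetric operator with an orthonormal eigenbasis -/

/-- For a symmetric `W` and a basis eigenvector `b` (`W b = μ b`, `μ` real), every `ν`-eigenvector `ξ`
with `μ ≠ ν` is orthogonal to `b`: `(μ − ν)⟪b, ξ⟫ = ⟪W b, ξ⟫ − ⟪b, W ξ⟫ = 0`. [cite: ConnesMoscovici2022, Thm 1.6 (iv) and its proof («discrete spectrum … finite multiplicity») (= arXiv:2112.05500 Thm 2.6 (iv), chunk p0006:L79, L95–L114); ReedSimonI1980, §VIII.2] -/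
theorem inner_eigenvector_eq_zero_of_ne {W : L2R →ₗ.[ℂ] L2R} (hW : W.IsSymmetric)
    {b ξ : L2R} {μ ν : ℝ} (hb : ∃ h : b ∈ W.domain, W ⟨b, h⟩ = ((μ : ℝ) : ℂ) • b)
    (hξ : ξ ∈ W.eigenspace ((ν : ℝ) : ℂ)) (hne : μ ≠ ν) : ⟪b, ξ⟫_ℂ = 0 := by
  obtain ⟨hbd, hbW⟩ := hb
  obtain ⟨hξd, hξW⟩ := mem_eigenspace_iff.1 hξ
  have h := hW ⟨b, hbd⟩ ⟨ξ, hξd⟩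
  -- `⟪W b, ξ⟫ = ⟪b, W ξ⟫` ⟹ `μ⟪b, ξ⟫ = ν⟪b, ξ⟫`
  have h' : ((μ : ℝ) : ℂ) * ⟪b, ξ⟫_ℂ = ((ν : ℝ) : ℂ) * ⟪b, ξ⟫_ℂ := by
    have h1 : ⟪(W ⟨b, hbd⟩ : L2R), ξ⟫_ℂ = (starRingEnd ℂ) ((μ : ℝ) : ℂ) * ⟪b, ξ⟫_ℂ := by
      rw [hbW, inner_smul_left]
    have h2 : ⟪b, (W ⟨ξ, hξd⟩ : L2R)⟫_ℂ = ((ν : ℝ) : ℂ) * ⟪b, ξ⟫_ℂ := by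
      rw [hξW, inner_smul_right]
    have h3 : (starRingEnd ℂ) ((μ : ℝ) : ℂ) = ((μ : ℝ) : ℂ) := Complex.conj_ofReal μ
    rw [← h3, ← h1, ← h2]
    exact h
  have h'' : (((μ : ℝ) : ℂ) - ((ν : ℝ) : ℂ)) * ⟪b, ξ⟫_ℂ = 0 := by rw [sub_mul, h', sub_self]
  rcases mul_eq_zero.1 h'' with h0 | h0
  · exact absurd (by exact_mod_cast sub_eq_zero.1 h0) hne
  · exact h0

/-- **Eigenvectors live in finitely many basis directions**: if `W` is symmetric with an orthonormal
eigenbasis `(b_n, μ_n)_{n ∈ ℕ}` and `μ_n ≠ ν` for all `n ≥ N`, then the `ν`-eigenspace of `W` lies in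
`span{b_0, …, b_{N−1}}`. [cite: ConnesMoscovici2022, Thm 1.6 (iv) and its proof («discrete spectrum … finite multiplicity») (= arXiv:2112.05500 Thm 2.6 (iv), chunk p0006:L79, L95–L114); ReedSimonI1980, §VIII.2] -/
theorem eigenspace_le_span_of_hilbertBasis {W : L2R →ₗ.[ℂ] L2R} (hW : W.IsSymmetric)
    (b : HilbertBasis ℕ ℂ L2R) (μ : ℕ → ℝ)
    (hb : ∀ n, ∃ h : (b n : L2R) ∈ W.domain, W ⟨b n, h⟩ = ((μ n : ℝ) : ℂ) • (b n : L2R))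
    {ν : ℝ} {N : ℕ} (hN : ∀ n, N ≤ n → μ n ≠ ν) :
    W.eigenspace ((ν : ℝ) : ℂ) ≤
      Submodule.span ℂ ((fun n : ℕ ↦ (b n : L2R)) '' (Finset.range N : Set ℕ)) := by
  intro ξ hξ
  -- the Fourier coefficients of `ξ` vanish off `range N`
  have hcoef : ∀ n ∉ Finset.range N, b.repr ξ n • (b n : L2R) = 0 := by
    intro n hn
    have hNn : N ≤ n := by simpa [Finset.mem_range, not_lt] using hn
    rw [HilbertBasis.repr_apply_apply, inner_eigenvector_eq_zero_of_ne hW (hb n) hξ (hN n hNn),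
      zero_smul]
  have h1 : HasSum (fun n ↦ b.repr ξ n • (b n : L2R)) ξ := b.hasSum_repr ξ
  have h2 : HasSum (fun n ↦ b.repr ξ n • (b n : L2R))
      (∑ n ∈ Finset.range N, b.repr ξ n • (b n : L2R)) := hasSum_sum_of_ne_finset_zero hcoef
  rw [h1.unique h2]
  refine Submodule.sum_mem _ fun n hn ↦ Submodule.smul_mem _ _ (Submodule.subset_span ?_)
  exact ⟨n, hn, rfl⟩

/-- **Bounded eigenvalue windows are finite-dimensional**: if `W` is symmetric with an orthonormal
eigenbasis `(b_n, μ_n)` and `|μ_n| → ∞`, then for every `R` the eigenspaces of `W` with real eigenvalue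
`ν`, `|ν| ≤ R`, drawn from any index family, span a finite-dimensional subspace («the eigenvalues … have
finite multiplicity»). [cite: ConnesMoscovici2022, Thm 1.6 (iv) and its proof (= arXiv:2112.05500 Thm 2.6 (iv), chunk p0006:L79, L95–L114); ReedSimonIV1978, Thm XIII.64] -/
theorem finiteDimensional_iSup_eigenspace_of_hasDiscreteSpectrum {W : L2R →ₗ.[ℂ] L2R}
    (hW : W.IsSymmetric) (hd : HasDiscreteSpectrumUnboundedBothSides W) (R : ℝ)
    {ι : Type*} (ν : ι → ℝ) (hν : ∀ i, |ν i| ≤ R) (V : ι → Submodule ℂ L2R)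
    (hV : ∀ i, V i ≤ W.eigenspace ((ν i : ℝ) : ℂ)) :
    FiniteDimensional ℂ (⨆ i, V i : Submodule ℂ L2R) := by
  obtain ⟨b, μ, hb, hT, -, -⟩ := hd
  -- beyond some `N`, `|μ n| > R`
  obtain ⟨N, hN⟩ := eventually_atTop.1 (hT.eventually_gt_atTop R)
  set S : Submodule ℂ L2R :=
    Submodule.span ℂ ((fun n : ℕ ↦ (b n : L2R)) '' (Finset.range N : Set ℕ)) with hS
  haveI : FiniteDimensional ℂ S :=
    FiniteDimensional.span_of_finite ℂ ((Finset.range N).finite_toSet.image _)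
  have hle : (⨆ i, V i : Submodule ℂ L2R) ≤ S := by
    refine iSup_le fun i ↦ (hV i).trans ?_
    refine eigenspace_le_span_of_hilbertBasis hW b μ hb fun n hn hμν ↦ ?_
    have h1 : R < |μ n| := hN n hn
    rw [hμν] at h1
    exact (lt_irrefl _) ((hν i).trans_lt h1)
  exact Submodule.finiteDimensional_of_le hle

/-! ## §2. Theorem 5.1, clause (2): finite multiplicity windows, for every `λ > 0` -/

/-- RH-FREE (PROVED). **[ConnesMoscovici2022, Thm 5.1], clause (2) as typed, for EVERY `λ > 0`**: for
`W = W_sa` and every `E`, the even-sector eigenspaces with eigenvalue in `[−(E/2)², 0)` span a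
finite-dimensional subspace of `L²(ℝ)` — from Thm 1.6 (iv) (orthonormal eigenbasis with `|μ_n| → ∞`,
the tree's `CM22_thm_1_6_iv`) and the self-adjointness of `W_sa`.  (The printed Thm 5.1 is at
`λ = √2`; clause (3), the counting asymptotics, is NOT proved here.)
[cite: ConnesMoscovici2022, Thm 5.1 and its proof («the number `N(E)` of such `ξ` is thus `2σ(E/2, √2)`») (= arXiv:2112.05500 Thm 6.1, chunk p0011:L6–L22), with Thm 1.6 (iv) (chunk p0006:L79)] -/
theorem CM22_thm_5_1_ii (hlam : 0 < lam) {W : L2R →ₗ.[ℂ] L2R} (hW : IsProlateSA lam W) (E : ℝ) :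
    FiniteDimensional ℂ
      (⨆ μ : {μ : ℝ // -(E / 2) ^ 2 ≤ μ ∧ μ < 0},
        W.eigenspace ((μ : ℝ) : ℂ) ⊓ ConnesConsani2021.evenPart : Submodule ℂ L2R) :=
  by
  have hν : ∀ μ : {μ : ℝ // -(E / 2) ^ 2 ≤ μ ∧ μ < 0}, |(μ : ℝ)| ≤ (E / 2) ^ 2 := by
    intro μ
    rw [abs_le]
    exact ⟨μ.2.1, by linarith [μ.2.2, sq_nonneg (E / 2)]⟩
  exact finiteDimensional_iSup_eigenspace_of_hasDiscreteSpectrum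
    (hW.isSelfAdjoint hlam).isSymmetric_linearPMap (CM22_thm_1_6_iv lam hlam W hW) ((E / 2) ^ 2)
    (fun μ : {μ : ℝ // -(E / 2) ^ 2 ≤ μ ∧ μ < 0} ↦ (μ : ℝ)) hν
    (fun μ : {μ : ℝ // -(E / 2) ^ 2 ≤ μ ∧ μ < 0} ↦
      (W.eigenspace ((μ : ℝ) : ℂ) ⊓ ConnesConsani2021.evenPart : Submodule ℂ L2R))
    fun _ ↦ inf_le_left

/-- The same for `W_sa = prolateSA λ` itself. [cite: ConnesMoscovici2022, Thm 5.1 (= arXiv:2112.05500 Thm 6.1, chunk p0011:L6–L22), with Thm 1.6 (iv)] -/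
theorem finiteDimensional_negEigenWindow_prolateSA (hlam : 0 < lam) (E : ℝ) :
    FiniteDimensional ℂ
      (⨆ μ : {μ : ℝ // -(E / 2) ^ 2 ≤ μ ∧ μ < 0},
        (prolateSA lam hlam).eigenspace ((μ : ℝ) : ℂ) ⊓ ConnesConsani2021.evenPart :
          Submodule ℂ L2R) :=
  CM22_thm_5_1_ii hlam (isProlateSA_prolateSA hlam) E

/-- Every eigenspace of `W_sa` (any eigenvalue `ν ∈ ℝ`) is finite-dimensional. [cite: ConnesMoscovici2022, Thm 1.6 (iv) («finite multiplicity») (= arXiv:2112.05500 Thm 2.6 (iv), chunk p0006:L79, L95–L114)] -/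
theorem finiteDimensional_eigenspace_of_isProlateSA (hlam : 0 < lam) {W : L2R →ₗ.[ℂ] L2R}
    (hW : IsProlateSA lam W) (ν : ℝ) :
    FiniteDimensional ℂ (W.eigenspace ((ν : ℝ) : ℂ)) := by
  have h := finiteDimensional_iSup_eigenspace_of_hasDiscreteSpectrum
    (hW.isSelfAdjoint hlam).isSymmetric_linearPMap (CM22_thm_1_6_iv lam hlam W hW) |ν|
    (ι := Unit) (fun _ ↦ ν) (fun _ ↦ le_rfl) (fun _ ↦ W.eigenspace ((ν : ℝ) : ℂ)) fun _ ↦ le_rfl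
  have hle : W.eigenspace ((ν : ℝ) : ℂ) ≤ (⨆ _ : Unit, W.eigenspace ((ν : ℝ) : ℂ) : Submodule ℂ L2R) :=
    le_iSup (fun _ : Unit ↦ W.eigenspace ((ν : ℝ) : ℂ)) ()
  exact Submodule.finiteDimensional_of_le hle

/-! ## §3. `CM22_thm_5_1` reduced to its counting clause -/

/-- RH-FREE (PROVED). **`CM22_thm_5_1` from its counting clause alone**: clauses (1) (simplicity of
negative even-sector eigenvalues — seat cc-t14 g2's `finrank_eigenspace_inf_evenPart_le_one`) and (2)
(finite multiplicity windows — `CM22_thm_5_1_ii`) are tree theorems, so the named fact rests on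
exactly the printed semiclassical count «`N(E) = (E/2π)(log(E/2π) − 1) + O(1)`» (= `2σ(E/2, √2)`,
Prop 3.2), recorded as printed and NOT proved here.  `CM22_thm_5_1` stays a named fact.
[cite: ConnesMoscovici2022, Thm 5.1 eq. (5.1) and its proof (= arXiv:2112.05500 Thm 6.1 (6.1), chunk p0011:L6–L22)] -/
theorem CM22_thm_5_1_of_counting
    (hcount : ∀ W : L2R →ₗ.[ℂ] L2R, IsProlateSA (Real.sqrt 2) W →
      (fun E : ℝ ↦ (negEigenCountEven W (E / 2) : ℝ) -
          E / (2 * π) * (Real.log (E / (2 * π)) - 1)) =O[atTop] fun _ ↦ (1 : ℝ)) :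
    CM22_thm_5_1 := by
  intro W hW
  have hlam : (0 : ℝ) < Real.sqrt 2 := Real.sqrt_pos.2 (by norm_num)
  exact ⟨fun μ hμ ↦ finrank_eigenspace_inf_evenPart_le_one (Real.sqrt 2) hlam hW hμ,
    fun E ↦ CM22_thm_5_1_ii hlam hW E, hcount W hW⟩

end Literature.NumberTheory.ConnesMoscovici2022

end
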